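import Summits.QuantumFields.BalabanUV.T4Continuum.Support.NE7SoftOperatorGaugePositivity
import Summits.QuantumFields.BalabanUV.T4Continuum.Support.NE7SoftOperatorEnergyForm
import Summits.QuantumFields.BalabanUV.T4Continuum.Support.NE3BlockPoincareTangent

/-!
# NE7ConstrainedPoincarePureGauge — THE PURE-GAUGE CASE OF THE CONSTRAINED POINCARÉ INEQUALITY (CP_W) OF F212: for `μ ∈ N(Q′(W))` (averaged-kernel gauges) and `g = D_Wμ`,
# `dirSq(D_Wμ) ≤ 4·n·M²·‖R D_W† g‖²` (`M = L^{j+1}`, `n = Fintype.card n`) — F210's gauge Poincaré `‖D_Wμ‖²_{nhs} ≤ 4M²‖Δ_Wμ‖²_{nhs}` + F209's `‖R D_W† (D_Wμ)‖² = Σ nhsNormSq(Δ_Wμ)`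
# + the operator∕Hilbert–Schmidt comparison; i.e. (CP_W) holds on pure gauges with `C₁ = 4nM²`, `C₂ = 0` (file 142 of the curved (APE), F213)

Cell `pub-balaban`, rung (B)+1 sub-cell t4, lineage `b2b-balaban-t4-ne7-p1` (CRUX PROVER NE7 #1 = OWNER of row NE7), generation 85; memo
`t4/b2b-balaban-t4-ne7-p1-g85/LAGRANGE-CARRIER.md` §13.
WHY.  F212 `NE7SoftOperatorEnergyForm.softSymOpKa_posDef_of_constrainedPoincare` reduced the positivity letter (P_a) of the END F204 to ONE norm inequality (CP_W)
«`dirSq(Fb) ≤ C₁·(curlSq_W(Fb)∕n + ‖R D_W† b‖²) + C₂·‖Q̄_W b‖²` for all skew torus 1-forms `b`»; being a norm inequality it is assembled over `b = t + D_Wμ + r` by the triangle inequality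
(memo §13).  THIS file is the middle piece: on pure gauges from `N(Q′(W))` the gauge-fixing square alone controls the field, with the k-uniform constant `4nM²`.
WHAT ([folklore]; 0 def, 0 sorry).  **`constrainedPoincare_pureGauge`** (the title; operator vs normalised Hilbert–Schmidt squares by row NE3's `NE3BlockPoincareTangent.dirSq_le_card_mul_sum_nhs`), and its
(CP_W)-shaped corollary **`constrainedPoincare_pureGauge'`** (right-hand side `C₁·(curlSq∕n + ‖R D† g‖²) + C₂·‖Q̄ g‖²` with `C₁ = 4nM²`, any `C₂ ≥ 0`).
HONEST FRAMING (page 1): (CP_W) on ALL skew forms NOT proved (slice and lift pieces and the decomposition remain); (P_a) NOT proved; (KL-B) at curved `W` NOT proved; (APE) on curved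
data NOT proved; NOT ONE-STEP, NOT NE7; spine 0∕9; finite T⁴ rung (B)+1 — NOT infinite volume, NOT mass gap, NOT `BetaPertH`, NOT Clay.  Continuum YM on T⁴ ⇐ BetaPertH ∧ nine spine
estimates (0/9 proved); BetaPertH ⇐ (D1) ∧ (D4) ∧ CAP+tail; G-an2-4 gates asym, D1 and NE2/3/4.
-/

set_option autoImplicit false

open scoped BigOperators InnerProductSpace Matrix Matrix.Norms.L2Operator
open Finset

namespace Summit.QuantumFields.BalabanUV.T4Continuum.NE7ConstrainedPoincarePureGauge

open Literature.MathematicalPhysics.QuantumFieldTheory.Balaban1983to89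
open B7Prop1Explicit B7Prop2Explicit UnitaryModel MatrixNorms
open T4AveragingDeficitWall (IsUnitaryCfg IsSkewDir SmallField dirSq curlSq)
open T4AveragingDeficitWallBoundary (periodBox IsPeriodicCfg)
open AveragingDeficitPeriodicCounting (IsPeriodicDir)
open AveragingDeficitMultiLevelPrep (LevelSmall)
open AveragingDeficitTwoLevelPrep (prop1Radius)
open SpreadLift (loopRad)
open BlockAveragePushDirGauge (gaugeDir isPeriodicDir_gaugeDir)
open NE3HilbertSchmidtTorus
open NE3.PairLandauB8 (avgKernelGauges covLapSite mem_avgKernelGauges_iff)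
open NE3EnergyHessContTwoTerm (curlSq_nonneg dirSq_nonneg)
open NE7BalabanSoftOperator
open NE7BalabanSoftOperatorMass
open NE7GaugeFixOnPureGauges (resS_mem_of_avgKernel coe_gradOpK_resS inner_gaugeFix_pureGauge)
open NE7SoftOperatorGaugePositivity (sum_nhsNormSq_gaugeDir_le_covLap)
open NE3BlockPoincareTangent (dirSq_le_card_mul_sum_nhs)

noncomputable section

variable {d : ℕ} {n : Type*} [Fintype n] [DecidableEq n]

section Carrier

variable [Nonempty n] {L N : ℕ} [NeZero N] (hL : 1 ≤ L) (hL2 : 2 ≤ L) (j : ℕ) [NeZero (N * L ^ (j + 1))]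
  {W : Site d → Fin d → (Matrix n n ℂ)ˣ} {x : ℝ} (hWu : IsUnitaryCfg W) (hWP : IsPeriodicCfg W ((N * L ^ (j + 1) : ℕ) : ℤ))
  (hx : 0 ≤ x) (hs : LevelSmall d L j x) (hWx : SmallField W x)

omit [NeZero N] in
include hL2 hWP hx hs hWx in
/-- **(CP_W) ON PURE GAUGES**: for `μ ∈ N(Q′(W))` and `g = D_Wμ` (as a skew torus 1-form), under row NE3's Poincaré regime `hsmall` (F210):
`dirSq (extF g) (periodBox P) ≤ 4·n·M²·⟪R D† g, R D† g⟫`, `M = L^{j+1}`. [folklore] -/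
theorem constrainedPoincare_pureGauge
    (hsmall : 8 * d * (((L : ℝ) ^ (j + 1)) * (((d : ℝ) - 1) * (((L : ℝ) ^ (j + 1)) - 1) * x)) ^ 2
      + 2 * (Fintype.card n * (4 * (d : ℝ) ^ 2 * ((L : ℝ) ^ (j + 1) - 1) ^ 2 * x + 16 * d * loopRad d L ((prop1Radius d L)^[j] x)) ^ 2) ≤ 1 / 2)
    {μ : Site d → Matrix n n ℂ} (hμ : μ ∈ avgKernelGauges (d := d) (n := n) L N (j + 1) W) :
    dirSq (extF (N * L ^ (j + 1))
        ((gradOpK hWu (N * L ^ (j + 1)) ⟨resS (N * L ^ (j + 1)) μ, resS_mem_of_avgKernel hμ⟩ : skewForms d n (N * L ^ (j + 1))) : Form d n (N * L ^ (j + 1))))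
        (periodBox (d := d) (N * L ^ (j + 1)))
      ≤ 4 * Fintype.card n * ((L : ℝ) ^ (j + 1)) ^ 2
        * ⟪landauProjK L N (j + 1) W
            ((LinearMap.adjoint (𝕜 := ℝ) (E := skewSecs d n (N * L ^ (j + 1))) (F := skewForms d n (N * L ^ (j + 1))) (gradOpK hWu (N * L ^ (j + 1)))
                : skewForms d n (N * L ^ (j + 1)) →ₗ[ℝ] skewSecs d n (N * L ^ (j + 1)))
              (gradOpK hWu (N * L ^ (j + 1)) ⟨resS (N * L ^ (j + 1)) μ, resS_mem_of_avgKernel hμ⟩)),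
           landauProjK L N (j + 1) W
            ((LinearMap.adjoint (𝕜 := ℝ) (E := skewSecs d n (N * L ^ (j + 1))) (F := skewForms d n (N * L ^ (j + 1))) (gradOpK hWu (N * L ^ (j + 1)))
                : skewForms d n (N * L ^ (j + 1)) →ₗ[ℝ] skewSecs d n (N * L ^ (j + 1)))
              (gradOpK hWu (N * L ^ (j + 1)) ⟨resS (N * L ^ (j + 1)) μ, resS_mem_of_avgKernel hμ⟩))⟫_ℝ := by
  obtain ⟨-, hμP, -⟩ := mem_avgKernelGauges_iff.mp hμ
  have hP : 1 ≤ N * L ^ (j + 1) := Nat.one_le_iff_ne_zero.mpr (NeZero.ne _)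
  rw [coe_gradOpK_resS hWu hμ, extF_resF _ (isPeriodicDir_gaugeDir hWP hμP), inner_gaugeFix_pureGauge hWu hP hWP hμ]
  have h1 := dirSq_le_card_mul_sum_nhs (gaugeDir W μ) (periodBox (d := d) (N * L ^ (j + 1)))
  have h2 := sum_nhsNormSq_gaugeDir_le_covLap (N := N) hL2 j hWu hWP hx hs hWx hsmall hμ
  have h3 := mul_le_mul_of_nonneg_left h2 (Nat.cast_nonneg (α := ℝ) (Fintype.card n))
  calc dirSq (gaugeDir W μ) (periodBox (d := d) (N * L ^ (j + 1)))
      ≤ Fintype.card n * ∑ y ∈ periodBox (d := d) (N * L ^ (j + 1)), ∑ κ : Fin d, nhsNormSq (gaugeDir W μ y κ) := h1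
    _ ≤ Fintype.card n * (4 * ((L : ℝ) ^ (j + 1)) ^ 2 * ∑ y ∈ periodBox (d := d) (N * L ^ (j + 1)), nhsNormSq (covLapSite W μ y)) := h3
    _ = 4 * Fintype.card n * ((L : ℝ) ^ (j + 1)) ^ 2 * ∑ y ∈ periodBox (d := d) (N * L ^ (j + 1)), nhsNormSq (covLapSite W μ y) := by ring

include hL2 hWP in
/-- **(CP_W) ON PURE GAUGES, IN F212's SHAPE**: with `C₁ = 4nM²` and any `C₂ ≥ 0`,
`dirSq (extF g) ≤ C₁·(curlSq W (extF g)∕n + ⟪R D† g, R D† g⟫) + C₂·⟪Q̄ g, Q̄ g⟫` for `g = D_Wμ`, `μ ∈ N(Q′(W))`. [folklore] -/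
theorem constrainedPoincare_pureGauge'
    (hsmall : 8 * d * (((L : ℝ) ^ (j + 1)) * (((d : ℝ) - 1) * (((L : ℝ) ^ (j + 1)) - 1) * x)) ^ 2
      + 2 * (Fintype.card n * (4 * (d : ℝ) ^ 2 * ((L : ℝ) ^ (j + 1) - 1) ^ 2 * x + 16 * d * loopRad d L ((prop1Radius d L)^[j] x)) ^ 2) ≤ 1 / 2)
    {C₂ : ℝ} (hC₂ : 0 ≤ C₂)
    {μ : Site d → Matrix n n ℂ} (hμ : μ ∈ avgKernelGauges (d := d) (n := n) L N (j + 1) W) :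
    dirSq (extF (N * L ^ (j + 1))
        ((gradOpK hWu (N * L ^ (j + 1)) ⟨resS (N * L ^ (j + 1)) μ, resS_mem_of_avgKernel hμ⟩ : skewForms d n (N * L ^ (j + 1))) : Form d n (N * L ^ (j + 1))))
        (periodBox (d := d) (N * L ^ (j + 1)))
      ≤ (4 * Fintype.card n * ((L : ℝ) ^ (j + 1)) ^ 2)
          * (curlSq W (extF (N * L ^ (j + 1))
                ((gradOpK hWu (N * L ^ (j + 1)) ⟨resS (N * L ^ (j + 1)) μ, resS_mem_of_avgKernel hμ⟩ : skewForms d n (N * L ^ (j + 1))) : Form d n (N * L ^ (j + 1))))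
                (periodBox (d := d) (N * L ^ (j + 1))) / (Fintype.card n : ℝ)
              + ⟪landauProjK L N (j + 1) W
                  ((LinearMap.adjoint (𝕜 := ℝ) (E := skewSecs d n (N * L ^ (j + 1))) (F := skewForms d n (N * L ^ (j + 1))) (gradOpK hWu (N * L ^ (j + 1)))
                      : skewForms d n (N * L ^ (j + 1)) →ₗ[ℝ] skewSecs d n (N * L ^ (j + 1)))
                    (gradOpK hWu (N * L ^ (j + 1)) ⟨resS (N * L ^ (j + 1)) μ, resS_mem_of_avgKernel hμ⟩)),
                 landauProjK L N (j + 1) W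
                  ((LinearMap.adjoint (𝕜 := ℝ) (E := skewSecs d n (N * L ^ (j + 1))) (F := skewForms d n (N * L ^ (j + 1))) (gradOpK hWu (N * L ^ (j + 1)))
                      : skewForms d n (N * L ^ (j + 1)) →ₗ[ℝ] skewSecs d n (N * L ^ (j + 1)))
                    (gradOpK hWu (N * L ^ (j + 1)) ⟨resS (N * L ^ (j + 1)) μ, resS_mem_of_avgKernel hμ⟩))⟫_ℝ)
        + C₂ * ⟪qbarOpK (N := N) hL j hWu hx hs hWx (gradOpK hWu (N * L ^ (j + 1)) ⟨resS (N * L ^ (j + 1)) μ, resS_mem_of_avgKernel hμ⟩),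
                qbarOpK (N := N) hL j hWu hx hs hWx (gradOpK hWu (N * L ^ (j + 1)) ⟨resS (N * L ^ (j + 1)) μ, resS_mem_of_avgKernel hμ⟩)⟫_ℝ := by
  have h := constrainedPoincare_pureGauge (N := N) hL2 j hWu hWP hx hs hWx hsmall hμ
  have hc : 0 ≤ curlSq W (extF (N * L ^ (j + 1))
      ((gradOpK hWu (N * L ^ (j + 1)) ⟨resS (N * L ^ (j + 1)) μ, resS_mem_of_avgKernel hμ⟩ : skewForms d n (N * L ^ (j + 1))) : Form d n (N * L ^ (j + 1))))
      (periodBox (d := d) (N * L ^ (j + 1))) / (Fintype.card n : ℝ) := div_nonneg (curlSq_nonneg _ _ _) (Nat.cast_nonneg _)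
  have hq : 0 ≤ ⟪qbarOpK (N := N) hL j hWu hx hs hWx (gradOpK hWu (N * L ^ (j + 1)) ⟨resS (N * L ^ (j + 1)) μ, resS_mem_of_avgKernel hμ⟩),
      qbarOpK (N := N) hL j hWu hx hs hWx (gradOpK hWu (N * L ^ (j + 1)) ⟨resS (N * L ^ (j + 1)) μ, resS_mem_of_avgKernel hμ⟩)⟫_ℝ := real_inner_self_nonneg
  have hM : 0 ≤ 4 * (Fintype.card n : ℝ) * ((L : ℝ) ^ (j + 1)) ^ 2 := by positivity
  nlinarith [mul_nonneg hM hc, mul_nonneg hC₂ hq]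

end Carrier

end

end Summit.QuantumFields.BalabanUV.T4Continuum.NE7ConstrainedPoincarePureGauge
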